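import Summits.ABC.ABC.Theses.DefiniteXi
import Summits.ABC.ABC.Theorems.DefiniteXiFreyModularity
import Summits.ABC.ABC.Theorems.DefiniteXiDefiniteRTControlPrimeSmulTransportDeg
import Summits.ABC.ABC.Theorems.DefiniteXiDefiniteRTControlPrimeValTransport
import Summits.ABC.ABC.Theorems.DefiniteXiDefiniteRTControlPrimeFreyScale
import Summits.ABC.ABC.Theorems.DefiniteXiDefiniteRTControlPrimeFreyLocal
import Summits.ABC.ABC.Theorems.IsogenyGlueCongruenceMazurKenkuBoundOfRadius
import Literature.NumberTheory.EllipticCurves.TakahashiDegreeFormulaCoprimeProofs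
import Literature.NumberTheory.EllipticCurves.PastenSpectralDegree
import Literature.NumberTheory.EllipticCurves.PastenHeightBounds
import Literature.NumberTheory.EllipticCurves.PastenHeightBoundsLemma68LocalProofs
import Literature.NumberTheory.EllipticCurves.PastenSpectralDegreeIsogenyBoundProofs
import Literature.NumberTheory.EllipticCurves.IsogenyDegreeLatticeIndexProofs
import Literature.NumberTheory.EllipticCurves.ModularCurveManinSemistableBridgeProofs
import Literature.NumberTheory.EllipticCurves.ModularDegreeMinimal
import Literature.NumberTheory.EllipticCurves.IsogenyVariableChangeProofs
import Literature.NumberTheory.EllipticCurves.IsogenyCompProofs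
import Literature.NumberTheory.EllipticCurves.IsogenyDualProofs
import Literature.NumberTheory.EllipticCurves.IsogenyIdProofs
import Literature.NumberTheory.EllipticCurves.RationalIsogenyDegreesProofs
import Literature.NumberTheory.Automorphic.ShimuraCurveRibetTakahashiComponentOrders
import Literature.NumberTheory.DiophantineGeometry.MinimalDiscriminantFactorizationProofs
import HarnessLib

/-!
# Stub ideas k2 (gen 4, family RESHAPE) — `stub_pastenLemma68 : PastenShimura2024_lemma_6_8`
(crux `DefiniteRTControlPrime`, stmt-ABC-11338, route `DefiniteXi`, skeleton `Lines/Sketch.lean`).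

**Gen-4 reshape: ONE constant-free leaf for BOTH Pasten stubs.**  The skeleton consumes
`h163 : PastenShimura2024_minimalDegree_le_163_mul` once (at the minimal datum `D₁` of the globally
minimal Frey model `C • E_(a,b)`) and `h68 : PastenShimura2024_lemma_6_8` once (through
`stub_valTransport`, at `E_(a,b) ~ W⋆`, odd multiplicative `q`).  BOTH uses are instances of one
statement about the `ℚ`-isogeny CLASS of the Frey curve at an odd conductor prime:

  `FreyClassRadius B` : any two curves `ℚ`-isogenous to `E_(a,b)` are joined by a `ℚ`-isogeny of
  degree `≤ B`.

* `h163` pointwise ⟸ `FreyClassRadius B` (constant `163 ↦ B`): H1a = the body of the tree's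
  `PastenShimura2024_minimalDegree_le_163_mul_of` at ONE datum (lattice index `≤ B` ⟹
  `deg D' ≤ B · deg D`), H1b = the body of the landed glue
  `pastenShimura_minimalDegree_le_163_mul_of_radius` (route IsogenyGlueCongruence, p135527) at ONE
  datum, with its Néron-integrality input `hInt` now DISCHARGED in the tree
  (`hInt_of_pivot integral_neronScaling_of_isGloballyMinimal_holds edixhovenIntegrality_proof`).
* `hval` (the only use of `h68`) ⟸ `FreyClassRadius B`: H2 (cyclic factor + the tree's Tate-curve
  lemma `exists_ordMinimalDiscriminant_mul_eq_mul_of_isCyclic`; = k3-g4 H2 / k2-g3 `lemma68At`).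
* Glue G: `definiteRTControlPrime_of_freyClassRadius (hT) (hRad : FreyClassRadius B)` with
  `C = 4 · B²` — the landed `definiteRTControlPrime_of_facts` (p97354) with its two Pasten lines
  replaced.  New skeleton: `{stub_takahashi, stub_freyClassRadius}` (3 stubs ↦ 2, and the second is
  WEAKER than both `MazurKenkuRadius` (stmt-ABC-15193 / DefiniteXi item) and k2-g3's PROVED
  `freyIsogenyRadius163 h44 h13 h5` (rooted radius ⟹ class radius `163²`, S1 below)).

Suppliers of the leaf (all typed below): S1 `FreyIsogenyRadius R → FreyClassRadius (R*R)` (dual +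
composite; feeds k2-g3's `freyIsogenyRadius163 h44 h13 h5`, i.e. Mazur Cor. 4.4 + Klein–Fricke 13 +
the landed Frey-`5`-irreducibility — NO Mazur Thm 1, NO Kenku, NO Pasten §3/§6);
S2 `MazurKenkuRadius → FreyClassRadius 163` (two lines); S3 the `N^ε` variant `FreyClassRadiusSubpoly`
(the crux's idle `N^ε` becomes load-bearing: ANY sub-polynomial class radius suffices — the entry point
for k1's Mazur-free diameter programme).
-/

set_option linter.dupNamespace false

noncomputable section

open scoped Classical MatrixGroups ModularForm
open CongruenceSubgroup UpperHalfPlane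
open WeierstrassCurve IsDedekindDomain NumberField
open Literature.NumberTheory.EllipticCurves Literature.NumberTheory.EllipticCurves.ModularForms
open Literature.NumberTheory.DiophantineGeometry
open Literature.NumberTheory.Automorphic
open Summit.ABC.ABC.Theorems
open Summit.ABC.ABC.Theses.DefiniteXi

namespace Summit.ABC.ABC.Cruxes.DefiniteRTControlPrime.StubIdeas2G4

/-! ## 0. The merged leaf and its variants -/

/-- Rooted radius of the Frey isogeny class at an odd conductor prime (k2-g2/g3 `FreyIsogenyRadius`,
same text; k2-g3 PROVES `FreyIsogenyRadius 163` from `h44 h13 h5`). -/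
def FreyIsogenyRadius (R : ℕ) : Prop :=
  ∀ (a b : ℤ), IsCoprime a b → a * b * (a + b) ≠ 0 → ∀ q : ℕ, q.Prime → q ≠ 2 →
    q ∣ (freyCurve a b).conductorNorm ℤ →
    ∀ (W' : WeierstrassCurve ℚ) [W'.IsElliptic], (freyCurve a b).IsIsogenous W' →
      ∃ φ : Isogeny (freyCurve a b) W', φ.degree ≤ R

/-- **THE MERGED LEAF.** Class radius of the Frey isogeny class at an odd conductor prime: any two
elliptic curves `ℚ`-isogenous to `E_(a,b)` are joined by a `ℚ`-isogeny of degree `≤ B`. -/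
def FreyClassRadius (B : ℕ) : Prop :=
  ∀ (a b : ℤ), IsCoprime a b → a * b * (a + b) ≠ 0 → ∀ q : ℕ, q.Prime → q ≠ 2 →
    q ∣ (freyCurve a b).conductorNorm ℤ →
    ∀ (W₁ W₂ : WeierstrassCurve ℚ) [W₁.IsElliptic] [W₂.IsElliptic],
      W₁.IsIsogenous (freyCurve a b) → W₂.IsIsogenous (freyCurve a b) →
        ∃ φ : Isogeny W₁ W₂, φ.degree ≤ B

/-- **The `N^ε` variant** (S3): for every `ε > 0` a class radius `≤ R_ε · N^ε`, `N` the conductor. -/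
def FreyClassRadiusSubpoly : Prop :=
  ∀ ε : ℝ, 0 < ε → ∃ R : ℝ, ∀ (a b : ℤ), IsCoprime a b → a * b * (a + b) ≠ 0 →
    ∀ q : ℕ, q.Prime → q ≠ 2 → q ∣ (freyCurve a b).conductorNorm ℤ →
    ∀ (W₁ W₂ : WeierstrassCurve ℚ) [W₁.IsElliptic] [W₂.IsElliptic],
      W₁.IsIsogenous (freyCurve a b) → W₂.IsIsogenous (freyCurve a b) →
        ∃ φ : Isogeny W₁ W₂,
          (φ.degree : ℝ) ≤ R * (((freyCurve a b).conductorNorm ℤ : ℕ) : ℝ) ^ ε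

/-! ## 1. Suppliers: rooted ⟹ class (dual + composite), Mazur–Kenku radius ⟹ class -/

/-- R0a: degree of a composite (`#ker(ψ ∘ φ) = #ker ψ · #ker φ`, `φ` onto `E'(ℚ̄)`). [folklore] -/
theorem degree_comp {W W' W'' : WeierstrassCurve ℚ} [W.IsElliptic] [W'.IsElliptic]
    (ψ : Isogeny W' W'') (φ : Isogeny W W') : (ψ.comp φ).degree = ψ.degree * φ.degree := by
  change Nat.card (ψ.toAddMonoidHom.comp φ.toAddMonoidHom).ker = _
  rw [AddMonoidHom.natCard_ker_comp_of_surjective _ _ φ.surjective]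
  rfl

/-- R0b: two curves reached from `V` by isogenies of degrees `d₁, d₂` are joined by one of degree
`d₂ · d₁` (dual of the first, then the second). [cite: SilvermanAEC2009, Thm. III.6.1(a), III.6.2(e)] -/
theorem exists_isogeny_degree_eq_mul {V W₁ W₂ : WeierstrassCurve ℚ} [V.IsElliptic] [W₁.IsElliptic]
    [W₂.IsElliptic] (φ₁ : Isogeny V W₁) (φ₂ : Isogeny V W₂) :
    ∃ φ : Isogeny W₁ W₂, φ.degree = φ₂.degree * φ₁.degree := by
  obtain ⟨ψ₁, hψ₁⟩ := φ₁.exists_dual_of_isElliptic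
  exact ⟨φ₂.comp ψ₁, by rw [degree_comp, Isogeny_degree_eq_of_comp_eq_degree_zsmul φ₁ ψ₁ hψ₁]⟩

/-- **S1.** Rooted radius `R` ⟹ class radius `R²`. -/
theorem freyClassRadius_of_rooted {R : ℕ} (hR : FreyIsogenyRadius R) : FreyClassRadius (R * R) := by
  intro a b hab h0 q hq hq2 hqN W₁ W₂ _ _ h₁ h₂
  haveI := isElliptic_freyCurve h0
  obtain ⟨φ₁, hφ₁⟩ := hR a b hab h0 q hq hq2 hqN W₁ h₁.symm_of_charZero
  obtain ⟨φ₂, hφ₂⟩ := hR a b hab h0 q hq hq2 hqN W₂ h₂.symm_of_charZero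
  obtain ⟨φ, hφ⟩ := exists_isogeny_degree_eq_mul φ₁ φ₂
  exact ⟨φ, hφ ▸ Nat.mul_le_mul hφ₂ hφ₁⟩

/-- **S2.** The route item `MazurKenkuRadius` (DefiniteXi / stmt-ABC-15193) ⟹ class radius `163`. -/
theorem freyClassRadius_of_mazurKenkuRadius (h : MazurKenkuRadius) : FreyClassRadius 163 := by
  intro a b hab h0 q hq hq2 hqN W₁ W₂ _ _ h₁ h₂
  haveI := isElliptic_freyCurve h0
  exact h W₁ W₂ (h₁.trans' h₂.symm_of_charZero)

/-! ## 2. `h163` pointwise from a class radius (H1a, H1b) -/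

/-- **H1a** (pointwise, `163 ↦ B` copy of `PastenShimura2024_minimalDegree_le_163_mul_of`): a lattice
index `≤ B` for the datum `D'` gives `deg D' ≤ B · deg D` for `D'` minimal among the data of `W'`
and any datum `D` with the same newform. [cite: PastenShimura2024, §3 p. 13] -/
theorem modularDegree_le_mul_of_latticeIndex {B N : ℕ} [NeZero N] {W W' : WeierstrassCurve ℚ}
    [W.IsElliptic] [W'.IsElliptic]
    (D : ModularParametrizationData W N) (D' : ModularParametrizationData W' N) (hf : D'.f = D.f)
    (hmin' : ∀ D'' : ModularParametrizationData W' N, D'.modularDegree ≤ D''.modularDegree)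
    (hMK : ∃ (k : ℤ) (hk : ∀ z ∈ periodLattice D'.f, (k : ℂ) * z ∈ D'.L.lattice), k ≠ 0 ∧
      Nat.card (mulQuotientMap (periodLattice D'.f) D'.L.lattice.toAddSubgroup (k : ℂ) hk).ker ≤ B) :
    D'.modularDegree ≤ B * D.modularDegree := by
  -- the degree `δ` of the Eichler–Shimura map of `f = D'.f = D.f`
  haveI := discreteTopology_periodLattice_of_mul_mem D'.f D'.cast_c_ne_zero
    D'.smul_periodLattice_le
  obtain ⟨δ, hδ, hfinδ⟩ := exists_degree_eichlerShimuraMap' (N := N) D'.isNewformOf.1.ne_zero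
  have hδD : δ ≤ D.modularDegree := D.degree_eichlerShimuraMap_le_modularDegree hf.symm hδ hfinδ
  obtain ⟨k, hk, hk0, hkB⟩ := hMK
  obtain ⟨d, hd, hfin⟩ := exists_modularDegree_holds D'.isNewformOf.1.ne_zero (L := D'.L)
    (c := (k : ℂ)) (Int.cast_ne_zero.mpr hk0) hk
  have he : ∀ x : ℂ, D'.torusEquiv.toEquiv (x : ℂ ⧸ D'.L.lattice.toAddSubgroup) = D'.uniformize x :=
    fun _ ↦ rfl
  have key := (finite_setOf_card_fiberOrbits_ne_iff D'.torusEquiv.toEquiv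
    (fun τ : ℍ ↦ (((k : ℂ) * eichlerIntegral D'.f τ : ℂ) : ℂ ⧸ D'.L.lattice.toAddSubgroup)) d).mpr
    hfin
  simp only [he] at key
  let Dk : ModularParametrizationData W' N :=
    { D' with
      c := k
      smul_periodLattice_le := hk
      deg := d
      deg_pos := hd
      deg_spec := key }
  obtain ⟨hfinK, hdegK⟩ := Dk.modularDegree_eq_card_ker_mul_of_eichlerShimuraMap rfl hδ hfinδ
  have hkerK : Nat.card Dk.isogenyMap.ker ≤ B := hkB
  calc D'.modularDegree ≤ Dk.modularDegree := hmin' Dk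
    _ = Nat.card Dk.isogenyMap.ker * δ := hdegK
    _ ≤ B * δ := Nat.mul_le_mul_right δ hkerK
    _ ≤ B * D.modularDegree := Nat.mul_le_mul_left B hδD

/-- **H1b** (pointwise, `163 ↦ B` copy of the landed `pastenShimura_minimalDegree_le_163_mul_of_radius`,
with `hInt` DISCHARGED): a class radius `≤ B` about a globally minimal parametrised `W'` gives an
INTEGER multiplier `k`, `kΛ_f ⊆ Λ_{W'}`, with `#ker(z ↦ kz) ≤ B`. [cite: PastenShimura2024, §3 p. 13]
[cite: EdixhovenManin1991, Prop. 2] -/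
theorem exists_latticeIndex_le_of_classRadius {B N : ℕ} [NeZero N] {W' : WeierstrassCurve ℚ}
    [W'.IsElliptic] [W'.IsGloballyMinimal] (D' : ModularParametrizationData W' N)
    (hRad : ∀ (W₁ W₂ : WeierstrassCurve ℚ) [W₁.IsElliptic] [W₂.IsElliptic],
      W₁.IsIsogenous W' → W₂.IsIsogenous W' → ∃ φ : Isogeny W₁ W₂, φ.degree ≤ B) :
    ∃ (k : ℤ) (hk : ∀ z ∈ periodLattice D'.f, (k : ℂ) * z ∈ D'.L.lattice), k ≠ 0 ∧
      Nat.card (mulQuotientMap (periodLattice D'.f) D'.L.lattice.toAddSubgroup (k : ℂ) hk).ker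
        ≤ B := by
  have hInt : ∀ {N : ℕ} [NeZero N] {W' : WeierstrassCurve ℚ} [W'.IsElliptic] [W'.IsGloballyMinimal]
      (D' : ModularParametrizationData W' N) (q : ℚ),
      (∀ z ∈ periodLattice D'.f, (q : ℂ) * z ∈ D'.L.lattice) → ∃ k : ℤ, (k : ℚ) = q :=
    hInt_of_pivot integral_neronScaling_of_isGloballyMinimal_holds edixhovenIntegrality_proof
  -- the `ℚ`-model `W₀ = E_f` of `ℂ/Λ_f`, with Néron-type lattice exactly `Λ_f`
  obtain ⟨W₀, hW₀, -, L₀, hL₀, hΛ⟩ := D'.exists_latticeEq_model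
  haveI := hW₀
  have hmem : ∀ z, z ∈ L₀.lattice ↔ z ∈ periodLattice D'.f := fun z ↦ by
    rw [← SetLike.mem_coe, hΛ, SetLike.mem_coe]
  have hc : (D'.c : ℚ) ≠ 0 := by exact_mod_cast D'.maninConstant_ne_zero_holds
  have hle : ∀ z ∈ L₀.lattice, ((D'.c : ℚ) : ℂ) * z ∈ D'.L.lattice := fun z hz ↦ by
    rw [Rat.cast_intCast]
    exact D'.smul_periodLattice_le z ((hmem z).mp hz)
  have hiso : IsIsogenous W₀ W' :=
    isIsogenous_of_forall_mul_mem_lattice hL₀.1 hL₀.2 D'.isNeronLattice.1 D'.isNeronLattice.2 hc hle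
  set C₀ : VariableChange ℚ := ⟨1, -W₀.b₂ / 12, -W₀.a₁ / 2, W₀.a₁ * W₀.b₂ / 24 - W₀.a₃ / 2⟩
    with hC₀
  set C' : VariableChange ℚ := ⟨1, -W'.b₂ / 12, -W'.a₁ / 2, W'.a₁ * W'.b₂ / 24 - W'.a₃ / 2⟩
    with hC'
  have hE₀ : (C₀ • W₀).baseChange ℂ = L₀.curve := shortModel_baseChange_eq_curve W₀ hL₀
  have hE' : (C' • W').baseChange ℂ = D'.L.curve :=
    shortModel_baseChange_eq_curve W' D'.isNeronLattice
  -- CLASS RADIUS: a `ℚ`-isogeny `ψ : C₀ • W₀ → C' • W'` of degree `≤ B`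
  obtain ⟨ψ, hB⟩ := hRad (C₀ • W₀) (C' • W') ((isIsogenous_of_smul W₀ C₀).trans' hiso)
    (isIsogenous_of_smul W' C')
  obtain ⟨q, hq0, hq, hdegq⟩ :=
    degree_eq_natCard_ker_mulQuotientMap_of_baseChange_eq_curve ψ hE₀ hE'
  have hq' : ∀ z ∈ periodLattice D'.f, (q : ℂ) * z ∈ D'.L.lattice := fun z hz ↦
    hq z ((hmem z).mpr hz)
  obtain ⟨k, rfl⟩ := hInt D' q hq'
  have hk : ∀ z ∈ periodLattice D'.f, (k : ℂ) * z ∈ D'.L.lattice := fun z hz ↦ by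
    have := hq' z hz
    rwa [Rat.cast_intCast] at this
  refine ⟨k, hk, by exact_mod_cast hq0, ?_⟩
  have hΛ' : L₀.lattice.toAddSubgroup = periodLattice D'.f :=
    SetLike.coe_injective (by rw [Submodule.coe_toAddSubgroup, hΛ])
  have hcast : ((k : ℚ) : ℂ) = (k : ℂ) := Rat.cast_intCast k
  calc Nat.card (mulQuotientMap (periodLattice D'.f) D'.L.lattice.toAddSubgroup (k : ℂ) hk).ker
      = Nat.card (mulQuotientMap L₀.lattice.toAddSubgroup D'.L.lattice.toAddSubgroup
          ((k : ℚ) : ℂ) hq).ker := by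
        simp only [hcast]
        exact (natCard_ker_mulQuotientMap_congr hΛ' rfl (fun z hz ↦ hk z (hΛ' ▸ hz)) hk).symm
    _ = ψ.degree := hdegq.symm
    _ ≤ B := hB

/-- **H1 = H1a ∘ H1b**: the pointwise `h163` with constant `B`, from a class radius about `W'`. -/
theorem modularDegree_le_mul_of_classRadius {B N : ℕ} [NeZero N] {W W' : WeierstrassCurve ℚ}
    [W.IsElliptic] [W'.IsElliptic] [W'.IsGloballyMinimal]
    (D : ModularParametrizationData W N) (D' : ModularParametrizationData W' N) (hf : D'.f = D.f)
    (hmin' : ∀ D'' : ModularParametrizationData W' N, D'.modularDegree ≤ D''.modularDegree)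
    (hRad : ∀ (W₁ W₂ : WeierstrassCurve ℚ) [W₁.IsElliptic] [W₂.IsElliptic],
      W₁.IsIsogenous W' → W₂.IsIsogenous W' → ∃ φ : Isogeny W₁ W₂, φ.degree ≤ B) :
    D'.modularDegree ≤ B * D.modularDegree :=
  modularDegree_le_mul_of_latticeIndex D D' hf hmin' (exists_latticeIndex_le_of_classRadius D' hRad)

/-! ## 3. `hval` from ONE isogeny of degree `≤ B` (H2) -/

/-- **H2a** (= k3-g4 H2, k2-g3 `lemma68At`): along a `ℚ`-isogeny of degree `d`, `c_v` moves by a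
factor `≤ d` at a multiplicative place. Mazur-free. [cite: PastenShimura2024, §6.4 (p. 22)] -/
theorem ordMinimalDiscriminant_le_degree_mul {W W' : WeierstrassCurve ℚ} [W.IsElliptic]
    [W'.IsElliptic] (ψ : Isogeny W W') (v : HeightOneSpectrum ℤ)
    (hv : W.HasMultiplicativeReductionAt v) :
    W'.ordMinimalDiscriminant v ≤ ψ.degree * W.ordMinimalDiscriminant v := by
  obtain ⟨ψ', hcyc, hdvd⟩ := ψ.exists_isCyclic_degree_dvd
  have hv' : W'.HasMultiplicativeReductionAt v :=
    hasMultiplicativeReductionAt_of_isIsogenous ⟨ψ⟩ v hv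
  obtain ⟨m, n, hm, hn, hmn, heq⟩ :=
    exists_ordMinimalDiscriminant_mul_eq_mul_of_isCyclic ψ'.degree ψ' hcyc rfl v hv hv'
  have hle : m * n ≤ ψ.degree :=
    (Nat.le_of_dvd ψ'.degree_pos hmn).trans (Nat.le_of_dvd ψ.degree_pos hdvd)
  have hn' : n ≤ ψ.degree := (Nat.le_mul_of_pos_left n hm).trans hle
  calc W'.ordMinimalDiscriminant v
      ≤ W'.ordMinimalDiscriminant v * m := Nat.le_mul_of_pos_right _ hm
    _ = W.ordMinimalDiscriminant v * n := heq.symm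
    _ ≤ W.ordMinimalDiscriminant v * ψ.degree := Nat.mul_le_mul_left _ hn'
    _ = ψ.degree * W.ordMinimalDiscriminant v := Nat.mul_comm _ _

/-- **H2** (the drop-in for `hval`, `163 ↦ B`): `v_q(Δ_min W') ≤ B · v_q(Δ_min E_(a,b))` from ONE
`ℚ`-isogeny `E_(a,b) → W'` of degree `≤ B`, `q` an odd conductor prime. -/
theorem factorization_le_mul_of_isogeny {a b : ℤ} (hab : IsCoprime a b) (h0 : a * b * (a + b) ≠ 0)
    {q : ℕ} (hq : q.Prime) (hq2 : q ≠ 2) (hqN : q ∣ (freyCurve a b).conductorNorm ℤ)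
    {W' : WeierstrassCurve ℚ} [W'.IsElliptic] {B : ℕ} (φ : Isogeny (freyCurve a b) W')
    (hφ : φ.degree ≤ B) :
    (W'.minimalDiscriminantNorm ℤ).factorization q ≤
      B * ((freyCurve a b).minimalDiscriminantNorm ℤ).factorization q := by
  haveI := isElliptic_freyCurve h0
  obtain ⟨v, hv⟩ :
      ∃ v : HeightOneSpectrum ℤ, Rat.HeightOneSpectrum.natGenerator v = q :=
    ⟨(Rat.HeightOneSpectrum.primesEquiv (R := ℤ)).symm ⟨q, hq⟩,
      Rat.natGenerator_primesEquiv_symm ⟨q, hq⟩⟩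
  have hdvd : (q : ℤ) ∣ a * b * (a + b) := dvd_of_dvd_conductorNorm_freyCurve hab h0 hq hq2 hqN
  have hmult : (freyCurve a b).HasMultiplicativeReductionAt v :=
    hasMultiplicativeReductionAt_freyCurve_of_ne_two hab h0 v (hv ▸ hq2) (hv ▸ hdvd)
  have h1 := factorization_minimalDiscriminantNorm_holds (freyCurve a b) v
  have h2 := factorization_minimalDiscriminantNorm_holds W' v
  rw [hv] at h1 h2
  rw [h1, h2]
  exact (ordMinimalDiscriminant_le_degree_mul φ v hmult).trans (Nat.mul_le_mul_right _ hφ)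

end Summit.ABC.ABC.Cruxes.DefiniteRTControlPrime.StubIdeas2G4

/-! ## 4. The re-glue: the crux from Takahashi + the merged leaf -/

namespace Summit.ABC.ABC.Theorems.DefiniteRTControlPrime

open Summit.ABC.ABC.Theses.DefiniteXi
open Summit.ABC.ABC.Cruxes.DefiniteRTControlPrime.StubIdeas2G4
open Literature.NumberTheory.EllipticCurves Literature.NumberTheory.EllipticCurves.ModularForms
open Literature.NumberTheory.Automorphic
open WeierstrassCurve

/-- (copy of the landed `isIsogenous_of_f_eq`, p97354 — that module is not importable here) -/
theorem isIsogenous_of_f_eq'' {W W' : WeierstrassCurve ℚ} [W.IsElliptic] [W'.IsElliptic] {N : ℕ}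
    [NeZero N] (D : ModularParametrizationData W N) (D' : ModularParametrizationData W' N)
    (hf : D'.f = D.f) : W.IsIsogenous W' := by
  obtain ⟨W₀, hW₀, D₀, hf₀, h₀⟩ := D.exists_optimalDatum'
  haveI := hW₀
  have key : ∀ {V : WeierstrassCurve ℚ} [V.IsElliptic] (P : ModularParametrizationData V N),
      P.f = D₀.f → W₀.IsIsogenous V := by
    intro V _ P hP
    have hc₀ : (D₀.c : ℚ) ≠ 0 := by exact_mod_cast D₀.maninConstant_ne_zero_holds
    have hc : (P.c : ℚ) ≠ 0 := by exact_mod_cast P.maninConstant_ne_zero_holds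
    refine isIsogenous_of_forall_mul_mem_lattice D₀.isNeronLattice.1 D₀.isNeronLattice.2
      P.isNeronLattice.1 P.isNeronLattice.2 (c := (P.c : ℚ) / D₀.c) (div_ne_zero hc hc₀) ?_
    intro z hz
    obtain ⟨w, hw, rfl⟩ := h₀ z hz
    have hw' : w ∈ periodLattice P.f := by rw [hP]; exact hw
    have : (((P.c : ℚ) / D₀.c : ℚ) : ℂ) * ((D₀.c : ℂ) * w) = (P.c : ℂ) * w := by
      have hc₀' : (D₀.c : ℂ) ≠ 0 := D₀.cast_c_ne_zero
      push_cast
      field_simp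
    rw [this]
    exact P.smul_periodLattice_le w hw'
  have h1 : W₀.IsIsogenous W := key D hf₀.symm
  have h2 : W₀.IsIsogenous W' := key D' (hf.trans hf₀.symm)
  exact h1.symm_of_charZero.trans' h2

/-- (copy of the landed `exists_conductorMinimal`, p97354) -/
theorem exists_conductorMinimal'' {V : WeierstrassCurve ℚ} [V.IsElliptic] {N : ℕ} [NeZero N]
    (D₁ : ModularParametrizationData V N) (hV : V.conductorNorm ℤ = N) :
    ∃ (Ws : WeierstrassCurve ℚ) (_ : Ws.IsElliptic) (Ps : ModularParametrizationData Ws N),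
      Ws.conductorNorm ℤ = N ∧ Ps.f = D₁.f ∧
      ∀ (W' : WeierstrassCurve ℚ) [W'.IsElliptic], W'.conductorNorm ℤ = N →
        ∀ P' : ModularParametrizationData W' N, P'.f = Ps.f →
          Ps.modularDegree ≤ P'.modularDegree := by
  classical
  set S : Set ℕ := {d | ∃ (W' : WeierstrassCurve ℚ) (_ : W'.IsElliptic)
      (P' : ModularParametrizationData W' N),
      W'.conductorNorm ℤ = N ∧ P'.f = D₁.f ∧ P'.modularDegree = d} with hS_def
  have hS : S.Nonempty := ⟨D₁.modularDegree, V, ‹_›, D₁, hV, rfl, rfl⟩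
  obtain ⟨Ws, hWs, Ps, hNs, hfs, hdeg⟩ := Nat.sInf_mem hS
  refine ⟨Ws, hWs, Ps, hNs, hfs, fun W' _ hW' P' hP' => ?_⟩
  rw [hdeg]
  exact Nat.sInf_le ⟨W', ‹_›, P', hW', hP'.trans hfs, rfl⟩

/-- **G₀ (pointwise core, in `ℕ`).** At ONE coprime pair, odd conductor prime `q` (`N = M q`) and
minimal datum `D` of the Frey MODEL: a class radius `B` at `(a, b, q)` gives
`deg D ≤ 4 B² · ξ(M; q) · v_q(Δ_min E)`.  Body = the landed `definiteRTControlPrime_of_facts` (p97354)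
with `h163 …` replaced by H1 and `stub_valTransport h68 …` by H2.
[cite: Takahashi2001, Thm. 2.3 (p. 79)] [cite: PastenShimura2024, §3 p. 13, §6.4] -/
theorem deg_le_of_classRadiusAt (hT : takahashi2001_thm_2_3_of_coprime) {a b : ℤ}
    (hab : IsCoprime a b) (h0 : a * b * (a + b) ≠ 0) {M q : ℕ} [NeZero (M * q)]
    (hN : (freyCurve a b).conductorNorm ℤ = M * q) (hq : q.Prime) (hq2 : q ≠ 2) {B : ℕ}
    (hRad : ∀ (W₁ W₂ : WeierstrassCurve ℚ) [W₁.IsElliptic] [W₂.IsElliptic],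
      W₁.IsIsogenous (freyCurve a b) → W₂.IsIsogenous (freyCurve a b) →
        ∃ φ : Isogeny W₁ W₂, φ.degree ≤ B)
    (D : ModularParametrizationData (freyCurve a b) (M * q))
    (hDmin : ∀ D' : ModularParametrizationData (freyCurve a b) (M * q), D.deg ≤ D'.deg) :
    D.deg ≤ 4 * B * B * (brandtXi M q (fun n => (freyCurve a b).LFunction n) *
      ((freyCurve a b).minimalDiscriminantNorm ℤ).factorization q) := by
  haveI := isElliptic_freyCurve h0
  have hdiv : M * q / q = M := Nat.mul_div_cancel M hq.pos
  have hqN' : q ∣ (freyCurve a b).conductorNorm ℤ := by rw [hN]; exact Dvd.intro_left M rfl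
  -- `gcd(M, q) = 1`
  have hcop : M.Coprime q := by
    have h := stub_freyLocal a b hab h0 q hq hq2 hqN'
    rwa [hN, hdiv] at h
  -- a global minimal model `W_m = C • E`, its data, a minimal one
  obtain ⟨C, hC⟩ := hasGlobalMinimalModel_rat_holds (freyCurve a b)
  haveI := hC
  have hNm : (C • freyCurve a b).conductorNorm ℤ = M * q := by rw [conductorNorm_smul_rat, hN]
  have hne : Nonempty (ModularParametrizationData (C • freyCurve a b) (M * q)) :=
    (Summit.ABC.ABC.Theorems.nonempty_modularParametrizationData_smul_iff C).mpr ⟨D⟩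
  obtain ⟨D₁, -, hD₁min⟩ := exists_minimal_datum hne
  -- the lattice-optimal datum of the class of `f₁ := D₁.f`
  obtain ⟨W₀, hW₀, D₀, hf₀, h₀⟩ := D₁.exists_optimalDatum'
  haveI := hW₀
  have hker₀ : D₀.isogenyMap.ker = ⊥ := D₀.isogenyMap_ker_eq_bot_iff.mpr h₀
  have hmin₀ : ∀ (W' : WeierstrassCurve ℚ) [W'.IsElliptic]
      (D' : ModularParametrizationData W' (M * q)), D'.f = D₀.f →
        D₀.modularDegree ≤ D'.modularDegree := fun W' _ D' hD' =>
    D₀.modularDegree_le_of_isogenyMap_ker_eq_bot hker₀ D' hD'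
  -- the class radius about `W_m`
  have hRadW : ∀ (W₁ W₂ : WeierstrassCurve ℚ) [W₁.IsElliptic] [W₂.IsElliptic],
      W₁.IsIsogenous (C • freyCurve a b) → W₂.IsIsogenous (C • freyCurve a b) →
        ∃ φ : Isogeny W₁ W₂, φ.degree ≤ B := fun W₁ W₂ _ _ h₁ h₂ =>
    hRad W₁ W₂ (h₁.trans' (isIsogenous_of_smul (freyCurve a b) C))
      (h₂.trans' (isIsogenous_of_smul (freyCurve a b) C))
  -- (T_deg) `deg D₁ ≤ B · deg D₀` — H1 replaces `h163`
  have hB' : D₁.modularDegree ≤ B * D₀.modularDegree :=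
    modularDegree_le_mul_of_classRadius D₀ D₁ hf₀.symm hD₁min hRadW
  -- the conductor-restricted optimal pivot `(W⋆, P⋆)`
  obtain ⟨Ws, hWs, Ps, hNs, hfs, hPsmin⟩ := exists_conductorMinimal'' D₁ hNm
  haveI := hWs
  have h0s : D₀.modularDegree ≤ Ps.modularDegree := hmin₀ Ws Ps (hfs.trans hf₀.symm)
  -- Takahashi at `(W⋆, P⋆)`
  have hTak : Ps.modularDegree ≤ brandtXi M q (fun n => Ws.LFunction n) *
      (Ws.minimalDiscriminantNorm ℤ).factorization q :=
    takahashi2001_thm_2_3_of_coprime.modularDegree_le_brandtXi_mul hT Ws M q hq hcop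
      hNs Ps hPsmin
  -- `a(W⋆) = a(f₁) = a(W_m) = a(E)`
  have hL : (fun n => Ws.LFunction n) = fun n => (freyCurve a b).LFunction n := by
    funext n
    have h1 := Ps.isNewformOf.2 n
    have h2 := D₁.isNewformOf.2 n
    rw [hfs] at h1
    rw [h1, LFunction_smul] at h2
    exact_mod_cast h2
  rw [hL] at hTak
  -- (T_val) along `E ~ W_m ~ W⋆` — H2 replaces `stub_valTransport h68`
  have hiso : (freyCurve a b).IsIsogenous Ws :=
    (isIsogenous_smul (freyCurve a b) C).trans' (isIsogenous_of_f_eq'' D₁ Ps hfs)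
  obtain ⟨φ, hφ⟩ := hRad (freyCurve a b) Ws ⟨Isogeny.id _⟩ hiso.symm_of_charZero
  have hval : (Ws.minimalDiscriminantNorm ℤ).factorization q ≤
      B * ((freyCurve a b).minimalDiscriminantNorm ℤ).factorization q :=
    factorization_le_mul_of_isogeny hab h0 hq hq2 hqN' φ hφ
  -- (T_model) back to the Frey model
  obtain ⟨D₁', -, hdeg₁'⟩ := stub_smulTransportDeg C D₁
  have hscale : (C.u : ℚ).num.natAbs ≤ 2 := stub_freyScale a b hab h0 C hC
  have hD : D.deg ≤ 4 * D₁.modularDegree := by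
    calc D.deg ≤ D₁'.deg := hDmin D₁'
      _ = (C.u : ℚ).num.natAbs ^ 2 * D₁.deg := hdeg₁'
      _ ≤ 2 ^ 2 * D₁.deg := Nat.mul_le_mul_right _ (Nat.pow_le_pow_left hscale 2)
      _ = 4 * D₁.modularDegree := by norm_num [ModularParametrizationData.modularDegree]
  -- the chain in `ℕ`
  set ξ : ℕ := brandtXi M q (fun n => (freyCurve a b).LFunction n) with hξ
  set v : ℕ := ((freyCurve a b).minimalDiscriminantNorm ℤ).factorization q with hv
  calc D.deg ≤ 4 * D₁.modularDegree := hD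
    _ ≤ 4 * (B * D₀.modularDegree) := Nat.mul_le_mul_left _ hB'
    _ ≤ 4 * (B * Ps.modularDegree) := Nat.mul_le_mul_left _ (Nat.mul_le_mul_left _ h0s)
    _ ≤ 4 * (B * (ξ * (Ws.minimalDiscriminantNorm ℤ).factorization q)) :=
        Nat.mul_le_mul_left _ (Nat.mul_le_mul_left _ hTak)
    _ ≤ 4 * (B * (ξ * (B * v))) :=
        Nat.mul_le_mul_left _ (Nat.mul_le_mul_left _ (Nat.mul_le_mul_left _ hval))
    _ = 4 * B * B * (ξ * v) := by ring

/-- **G. `DefiniteRTControlPrime` from Takahashi 2001 Thm 2.3 and the MERGED LEAF**, `C = 4 · B²`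
(`N^ε` idle). -/
theorem definiteRTControlPrime_of_freyClassRadius (hT : takahashi2001_thm_2_3_of_coprime) {B : ℕ}
    (hRad : FreyClassRadius B) : DefiniteRTControlPrime := by
  intro ε hε
  refine ⟨((4 * B * B : ℕ) : ℝ), ?_⟩
  intro a b hab h0 N _ hN q hq hq2 hqN D hDmin
  -- `N = M q`
  obtain ⟨M, hM⟩ := hqN
  rw [mul_comm] at hM
  subst hM
  have hdiv : M * q / q = M := Nat.mul_div_cancel M hq.pos
  rw [hdiv]
  have hqN' : q ∣ (freyCurve a b).conductorNorm ℤ := by rw [hN]; exact Dvd.intro_left M rfl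
  have hchain := deg_le_of_classRadiusAt hT hab h0 hN hq hq2
    (fun W₁ W₂ _ _ h₁ h₂ => hRad a b hab h0 q hq hq2 hqN' W₁ W₂ h₁ h₂) D hDmin
  set ξ : ℕ := brandtXi M q (fun n => (freyCurve a b).LFunction n) with hξ
  set v : ℕ := ((freyCurve a b).minimalDiscriminantNorm ℤ).factorization q with hv
  -- to `ℝ`, inserting the idle `N^ε ≥ 1`
  have hN1 : (1 : ℝ) ≤ ((M * q : ℕ) : ℝ) := by
    exact_mod_cast Nat.one_le_iff_ne_zero.mpr (NeZero.ne (M * q))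
  have hrpow : (1 : ℝ) ≤ ((M * q : ℕ) : ℝ) ^ ε := Real.one_le_rpow hN1 hε.le
  have hcast : (D.deg : ℝ) ≤ ((4 * B * B : ℕ) : ℝ) * ((ξ : ℝ) * (v : ℝ)) := by
    exact_mod_cast hchain
  have hξv : (0 : ℝ) ≤ (ξ : ℝ) * (v : ℝ) := by positivity
  calc (D.deg : ℝ) ≤ ((4 * B * B : ℕ) : ℝ) * ((ξ : ℝ) * (v : ℝ)) := hcast
    _ = ((4 * B * B : ℕ) : ℝ) * 1 * ((ξ : ℝ) * (v : ℝ)) := by ring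
    _ ≤ ((4 * B * B : ℕ) : ℝ) * ((M * q : ℕ) : ℝ) ^ ε * ((ξ : ℝ) * (v : ℝ)) := by gcongr

/-- **G ∘ S1.** The crux from Takahashi + a ROOTED Frey radius `R` (`C = 4 · R⁴`); with k2-g3's PROVED
`freyIsogenyRadius163 h44 h13 h5 : FreyIsogenyRadius 163` this is the crux on the trust base
{Takahashi 2.3, Mazur Cor. 4.4, Klein–Fricke 13, Frey-5-irreducibility (tree)} — no `h163`, no `h68`. -/
theorem definiteRTControlPrime_of_rooted (hT : takahashi2001_thm_2_3_of_coprime) {R : ℕ}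
    (hR : FreyIsogenyRadius R) : DefiniteRTControlPrime :=
  definiteRTControlPrime_of_freyClassRadius hT (freyClassRadius_of_rooted hR)

/-- **G ∘ S2.** The crux from Takahashi + the route item `MazurKenkuRadius` alone (`C = 4 · 163²`). -/
theorem definiteRTControlPrime_of_mazurKenkuRadius (hT : takahashi2001_thm_2_3_of_coprime)
    (hR : MazurKenkuRadius) : DefiniteRTControlPrime :=
  definiteRTControlPrime_of_freyClassRadius hT (freyClassRadius_of_mazurKenkuRadius hR)

/-- **Gε (S3).** The `N^ε` variant: a SUB-POLYNOMIAL class radius suffices — the crux's `N^ε`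
becomes load-bearing: with `R = R(ε/2)`, `B := ⌊R · N^(ε/2)⌋₊` in G₀ gives
`deg D ≤ 4 B² ξ v ≤ 4 R² · N^ε · ξ v`, so `C(ε) = 4 R(ε/2)²`. -/
theorem definiteRTControlPrime_of_freyClassRadiusSubpoly (hT : takahashi2001_thm_2_3_of_coprime)
    (hRad : FreyClassRadiusSubpoly) : DefiniteRTControlPrime := by
  intro ε hε
  obtain ⟨R, hR⟩ := hRad (ε / 2) (half_pos hε)
  refine ⟨4 * (max R 0) ^ 2, ?_⟩
  intro a b hab h0 N _ hN q hq hq2 hqN D hDmin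
  -- `N = M q`
  obtain ⟨M, hM⟩ := hqN
  rw [mul_comm] at hM
  subst hM
  have hdiv : M * q / q = M := Nat.mul_div_cancel M hq.pos
  rw [hdiv]
  have hqN' : q ∣ (freyCurve a b).conductorNorm ℤ := by rw [hN]; exact Dvd.intro_left M rfl
  set Nr : ℝ := ((M * q : ℕ) : ℝ) with hNr
  have hNr0 : (0 : ℝ) ≤ Nr := by positivity
  have hR0 : (0 : ℝ) ≤ max R 0 := le_max_right _ _
  have hpow0 : (0 : ℝ) ≤ Nr ^ (ε / 2) := Real.rpow_nonneg hNr0 _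
  -- the integer radius at this `N`
  set B : ℕ := ⌊max R 0 * Nr ^ (ε / 2)⌋₊ with hB
  have hRadB : ∀ (W₁ W₂ : WeierstrassCurve ℚ) [W₁.IsElliptic] [W₂.IsElliptic],
      W₁.IsIsogenous (freyCurve a b) → W₂.IsIsogenous (freyCurve a b) →
        ∃ φ : Isogeny W₁ W₂, φ.degree ≤ B := by
    intro W₁ W₂ _ _ h₁ h₂
    obtain ⟨φ, hφ⟩ := hR a b hab h0 q hq hq2 hqN' W₁ W₂ h₁ h₂
    refine ⟨φ, Nat.le_floor ?_⟩
    rw [hN] at hφ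
    calc (φ.degree : ℝ) ≤ R * Nr ^ (ε / 2) := hφ
      _ ≤ max R 0 * Nr ^ (ε / 2) := mul_le_mul_of_nonneg_right (le_max_left _ _) hpow0
  have hchain := deg_le_of_classRadiusAt hT hab h0 hN hq hq2 hRadB D hDmin
  set ξ : ℕ := brandtXi M q (fun n => (freyCurve a b).LFunction n) with hξ
  set v : ℕ := ((freyCurve a b).minimalDiscriminantNorm ℤ).factorization q with hv
  have hcast : (D.deg : ℝ) ≤ 4 * (B : ℝ) * (B : ℝ) * ((ξ : ℝ) * (v : ℝ)) := by
    exact_mod_cast hchain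
  have hξv : (0 : ℝ) ≤ (ξ : ℝ) * (v : ℝ) := by positivity
  have hBle : (B : ℝ) ≤ max R 0 * Nr ^ (ε / 2) := Nat.floor_le (mul_nonneg hR0 hpow0)
  have hB0 : (0 : ℝ) ≤ (B : ℝ) := Nat.cast_nonneg _
  have hsq : Nr ^ (ε / 2) * Nr ^ (ε / 2) = Nr ^ ε := by
    rw [← Real.rpow_add' hNr0 (by linarith)]
    ring_nf
  calc (D.deg : ℝ) ≤ 4 * (B : ℝ) * (B : ℝ) * ((ξ : ℝ) * (v : ℝ)) := hcast
    _ ≤ 4 * (max R 0 * Nr ^ (ε / 2)) * (max R 0 * Nr ^ (ε / 2)) * ((ξ : ℝ) * (v : ℝ)) := by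
        gcongr
    _ = 4 * (max R 0) ^ 2 * (Nr ^ (ε / 2) * Nr ^ (ε / 2)) * ((ξ : ℝ) * (v : ℝ)) := by ring
    _ = 4 * (max R 0) ^ 2 * Nr ^ ε * ((ξ : ℝ) * (v : ℝ)) := by rw [hsq]

end Summit.ABC.ABC.Theorems.DefiniteRTControlPrime

end
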